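import Literature.MathematicalPhysics.QuantumFieldTheory.Balaban1983to89.B13JointWalkExpansionNeumann
import Literature.MathematicalPhysics.QuantumFieldTheory.Balaban1983to89.B13DomainKernelWalksDecay

/-!
# `Balaban1983to89.B13ParametrixNeumannWalks` — T. Bałaban, *Propagators for lattice gauge theories in a background field*,
Commun. Math. Phys. **99** (1985) 389–434 [Balaban1985BackgroundPropagators] («[13]» of [Balaban1988RG2Cluster]), THE
MECHANISM OF THEOREM 3.10 (pp. 413–416) IN THE [B13] CURRENCY: (3.87) `G₀ = Σ_{□∈𝒟} h_□G_□h_□` (the parametrix: one-step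
operators localised in domains), (3.105) `Δ_aG₀ = I − R` with `R` a sum of domain-localised one-step operators each carrying
*"a bound of the type (3.89)"* (small), (3.106) *"For M sufficiently large this implies G = G₀(I − R)⁻¹ = Σ_{n=0}^∞ G₀Rⁿ"*,
and the conclusion (3.107)–(3.108) *"G = Σ_ω R₀(X₀)R_{α₁}(X₁)·⋯·R_{αₙ}(Xₙ) … A term in this expansion, corresponding to a walk
ω, … satisfies the inequality … e^{−½δ₀d(ω,y,y′)} … The constant O(1) depends on d and L only"* — HERE: for ANY two
domain-localised one-step families at complex backgrounds (`B13DomainKernelWalksDecay.IsDomainLocalD`: the tree's typing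
of print's factors `R_α(X)`, p. 413 *"it is localized in X, i.e. its kernel has a support in X × X, it depends on U
restricted to X̃⁵, and satisfies a bound of the type (3.89)"*), seed `G₀` and SMALL step family `R`, the operator
`G₀·(1 − R)⁻¹` IS a joint walk expansion (`B13JointWalkExpansion.JointWalkExpansion`, all eight fields) on EVERY torus,
with walks = (chain of step pieces, seed piece), letters INDEPENDENT OF THE TORUS, under ONE margin smallness `q < 1`
(«M sufficiently large»)

statement-level bookkeeping over published theorems with citation tags; kernel-checked compositions of tree theorems;
nothing here is a claim about the Yang–Mills mass gap.

WHY (cell `pub-ymgap`, D-0062 Track A, node N10 = [B13]; seat `pub-ymgap-dag-n10-c` g4, module 27; FAN-OUT v1.1 §N10 s1 ≡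
§N06 s4 «`JointWalkExpansion`s for `G_k(U)`-built kernels»).  After modules 25–26 the N10 junction's NODE-A input
(census class A2′) is ONE σ-free joint walk expansion of the fluctuation operator through `X` at complex backgrounds, and
the Literature walk calculus is closed under re-indexing ∕ transposition ∕ scalars ∕ sums ∕ products
(`B13JointWalkExpansionAlgebra`) AND resolvents (`B13JointWalkExpansionNeumann`).  [13] builds every propagator `G_k(Ω)`
as parametrix × Neumann series over one-step factors; THIS FILE types that construction's OUTPUT as a member of the shape,
so that «a `G_k(U)`-built kernel» — any finite sum ∕ product of local operators and of such resolvents — is walk-expanded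
BY NAME the moment its one-step factors are supplied as `IsDomainLocalD` data with k-uniform letters at complex
backgrounds (the located content of N06's row s1 (β) ∕ cell GAPS G-B9-05∕06a∕07, complexified per [II] p. 15).

WHAT THIS FILE PROVES (all `theorem`s; geometry `toB6 (torusGeom Nf 0 0 0) 0 True` = the one-scale ℓ¹ site torus).
§1 ★ `jointWalkExpansion_parametrixNeumann` — DATA: a seed family `L₀` (rows `q` located by `locq`, columns `n` by
   `locn`; `IsDomainLocalD L₀ c locq locn X R λ₀ ρ₀ r₀ m₀ n₀`: supports in domains of diameter `≤ r₀`, `≤ n₀` pieces per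
   anchor, `|J_b| ≤ m₀`, entries analytic on the `R`-ball and `≤ λ₀e^{−ρ₀D_b}`) and a step family `L_R` (square on `n`;
   `IsDomainLocalD L_R c locn locn X R λ_R ρ_R r_R m_R n_R`), fibre multiplicity `m` of `locn`; a target package: chain
   rate `ρ`, window `ε ≥ 0`, torus rate `κ ≥ 0` and ONE junction rate `μ > 0` with `κ + 2μ ≤ ρ − ε`, `ρ + μ ≤ ρ_R`,
   `ρ ≤ ρ₀`; the MARGIN SMALLNESS `q = (m·c_μ)·K̄_R·c_μ < 1`, `K̄_R = λ_Re^{κ₁m_R}e^{μr_R}n_Rc_μ`, `c_μ = c₀(1,μ)^ν` (the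
   (2.61) constant on every torus, `B13LocalKernelWalks.rowSum_torus`).  CONCLUSION: `(σ,u) ↦ L₀.kernel σ u·(1 − L_R.kernel
   σ u)⁻¹` is a `JointWalkExpansion` through `X` at `(R, ε, κ, K̄₀(1 − q)⁻¹)`, `K̄₀ = λ₀e^{κ₁m₀}e^{μr₀}n₀c_μ`, rate `ρ`,
   with terms `T₀(b)·T_R(iₙ)⋯T_R(i₁)` on `List L_R.B × L₀.B`, amplitudes `chainConst m c_μ (λ_Re^{κ₁m_R}) (λ₀e^{κ₁m₀})`,
   distances the chain distances of the one-point distances (3.93) — NO DEPENDENCE ON `Nf`;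
   `domBy_parametrixNeumann`; `one_sub_kernel_mul_inv` (invertibility of `1 − R` under `q < 1` alone).
§2 `jointWalkExpansion_parametrixNeumann_sigmaFree` — the σ-FREE reading (`m₀ = m_R = 0`: no piece carries a decoupling
   parameter, so the kernels and terms do not depend on `σ`): the conclusion in the literal σ-free form
   `JointWalkExpansion c locq locn (fun _ u => G u) … (fun ω _ u => T ω u) ∅ …` that module 25's
   `structuredExpansion_sandwich_sDecorate_symm` consumes (via `jointWalkExpansion_congr_terms`: the terms enter the
   shape only pointwise).
HONEST FRAMING: MODEL ∕ MECHANISM level (finite sums, the (2.61) row sum, the tree's Neumann closure) over HYPOTHESIS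
data; NOTHING of Bałaban's `G_k(Ω)`, `G₀`, `R`, `Δ_k`, `C^{(k)}` is constructed or asserted — whether HIS parametrix pieces
`h_□G_□h_□` and remainder pieces (the four families of (3.105), with the Leibniz letters of (3.99)–(3.104)) are
`IsDomainLocalD` data with k-UNIFORM letters AT COMPLEX BACKGROUNDS, and with `q < 1` at the printed `O(M⁻¹)`, is exactly
Theorem 3.10's located content (node N06 ∕ GAPS G-B9-05∕06a∕07) and stays the INPUT; (D4) ∕ NODE A NOT discharged;
count-neutral; NOT a discharge of N10; no `sorry`, no `def`, no new named fact; standard axioms; nothing continuum ∕ ℝ⁴ ∕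
OS ∕ mass gap ∕ Clay.
-/

noncomputable section

namespace Literature.MathematicalPhysics.QuantumFieldTheory.Balaban1983to89.B13ParametrixNeumannWalks

open Metric Set Finset
open scoped Matrix
open Literature.MathematicalPhysics.QuantumFieldTheory.Balaban1983to89
open Literature.MathematicalPhysics.QuantumFieldTheory.Balaban1983to89.B9SectDWalk (Through MajSumLe DomBy chainConst chainDist)
open Literature.MathematicalPhysics.QuantumFieldTheory.Balaban1983to89.B9Thm34Ext (toB6)
open Literature.MathematicalPhysics.QuantumFieldTheory.Balaban1983to89.B9Thm37GlueTorus (torusGeom tdist1 tdist1_nonneg)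
open Literature.MathematicalPhysics.QuantumFieldTheory.Balaban1983to89.TreeLengthTorus (TPt)
open Literature.MathematicalPhysics.QuantumFieldTheory.Balaban1983to89.B5TorusCover (UT)
open Literature.MathematicalPhysics.QuantumFieldTheory.Balaban1983to89.B11SectG (RowSum)
open Literature.MathematicalPhysics.QuantumFieldTheory.Balaban1983to89.B13JointWalkExpansion (JointWalkExpansion)
open Literature.MathematicalPhysics.QuantumFieldTheory.Balaban1983to89.B13LocalKernelWalks (rowSum_torus)
open Literature.MathematicalPhysics.QuantumFieldTheory.Balaban1983to89.B13DomainKernelWalks (DomainTerms)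
open Literature.MathematicalPhysics.QuantumFieldTheory.Balaban1983to89.B13DomainKernelWalksDecay
  (IsDomainLocalD jointWalkExpansion_domainLocalD)
open Literature.MathematicalPhysics.QuantumFieldTheory.Balaban1983to89.B13JointWalkExpansionNeumann
  (jointWalkExpansion_neumann_right domBy_chain_right one_sub_mul_inv_of_jointWalkExpansion)

variable {ν : ℕ} {Nf : Fin ν → ℕ} [∀ i, NeZero (Nf i)]
variable {d N' : ℕ} {n q : Type} [Fintype n] [DecidableEq n]
variable {E : Type*} [NormedAddCommGroup E] [NormedSpace ℂ E]

/-! ## §1. Parametrix × Neumann over domain-localised one-step factors is a joint walk expansion on every torus -/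

section Mechanism

variable {c : B13.Consts} {locn : n → UT Nf} {locq : q → UT Nf} {X : Finset (UT Nf)} {R : ℝ}
variable {L₀ : DomainTerms d N' ν Nf q n E} {LR : DomainTerms d N' ν Nf n n E}
variable {lam₀ ρ₀ r₀ lamR ρR rR : ℝ} {m₀ n₀ mR nR m : ℕ}

/-- **THEOREM 3.10's MECHANISM IN [B13] CURRENCY — `G₀·(1 − R)⁻¹` IS A JOINT WALK EXPANSION ON EVERY TORUS, LETTERS FREE
OF THE TORUS.**  See the module docstring for the data.  Bookkeeping: both one-step families are joint walk expansions by
`B13DomainKernelWalksDecay.jointWalkExpansion_domainLocalD` at the windows `ρ_R − (ρ − ε)` resp. `ρ₀ − (ρ − ε)` and the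
torus rate `κ + μ` (row sum (2.61) at rate `μ` on every torus, `rowSum_torus`); the resolvent step is
`B13JointWalkExpansionNeumann.jointWalkExpansion_neumann_right` with junction rate `σ₁ = μ` and summation rate `σ′ = μ`
— so the whole construction costs `2μ` below the reduced rate (`κ + 2μ ≤ ρ − ε`) and ONE margin smallness `q < 1`, once
for all chain lengths. [cite: Balaban1985BackgroundPropagators, (3.87) p.409, p.413, (3.105)–(3.106) p.414, Thm 3.10 (3.107)–(3.108) p.416, (3.93) p.410, (3.130) p.421, p.422; Balaban1988RG2Cluster, (1.11) p.5, p.13, p.15; Balaban1984PropagatorsII, (2.54) p.233, Lemma 2.1 (2.61) p.234] -/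
theorem jointWalkExpansion_parametrixNeumann
    (h₀ : IsDomainLocalD L₀ c locq locn X R lam₀ ρ₀ r₀ m₀ n₀) (hR : IsDomainLocalD LR c locn locn X R lamR ρR rR mR nR)
    (hκ₁ : 0 ≤ c.κ₁) (hlam₀ : 0 ≤ lam₀) (hlamR : 0 ≤ lamR)
    (hfib : ∀ y : UT Nf, (Finset.univ.filter fun k => locn k = y).card ≤ m)
    {ρ ε κ μ : ℝ} (hμ : 0 < μ) (hε : 0 ≤ ε) (hκ : 0 ≤ κ) (hwin : κ + 2 * μ ≤ ρ - ε) (hρR : ρ + μ ≤ ρR) (hρ₀ : ρ ≤ ρ₀)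
    (hq : (m * B6.c0 1 μ ^ ν) * ((lamR * Real.exp (c.κ₁ * mR)) * Real.exp (μ * rR) * (nR * B6.c0 1 μ ^ ν)) *
      B6.c0 1 μ ^ ν < 1) :
    JointWalkExpansion c locq locn (fun σ u => L₀.kernel σ u * (1 - LR.kernel σ u)⁻¹) X R ε κ
      (((lam₀ * Real.exp (c.κ₁ * m₀)) * Real.exp (μ * r₀) * (n₀ * B6.c0 1 μ ^ ν)) *
        (1 - (m * B6.c0 1 μ ^ ν) * ((lamR * Real.exp (c.κ₁ * mR)) * Real.exp (μ * rR) * (nR * B6.c0 1 μ ^ ν)) *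
          B6.c0 1 μ ^ ν)⁻¹)
      (fun (p : List LR.B × L₀.B) σ u => p.1.foldr (fun i M => M * LR.term i σ u) (L₀.term p.2 σ u))
      {p | p.2 ∈ L₀.sigmaCarrying ∨ ∃ i ∈ p.1, i ∈ LR.sigmaCarrying}
      (fun p => chainConst (m : ℝ) (B6.c0 1 μ ^ ν) (fun _ : LR.B => lamR * Real.exp (c.κ₁ * mR))
        (lam₀ * Real.exp (c.κ₁ * m₀)) p.1)
      (fun p a b => chainDist (g := toB6 (torusGeom Nf 0 0 0) 0 True) (fun i a b => LR.dist X i b a)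
        (fun a b => L₀.dist X p.2 b a) p.1 b a) ρ := by
  have hρ : 0 ≤ ρ := by linarith
  have hc : 0 ≤ B6.c0 1 μ ^ ν := pow_nonneg (B6RandomWalk.c0_nonneg 1 μ) ν
  -- the two one-step families as joint walk expansions (windows chosen so that both reduced rates are `ρ − ε`)
  have hS := jointWalkExpansion_domainLocalD h₀ hκ₁ hlam₀ (ε := ρ₀ - (ρ - ε)) (κ := κ + μ) (μ := μ)
    (hρ.trans hρ₀) (by linarith) hμ.le (by linarith) (rowSum_torus Nf hμ)
  have hK := jointWalkExpansion_domainLocalD hR hκ₁ hlamR (ε := ρR - (ρ - ε)) (κ := κ + μ) (μ := μ)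
    (by linarith) (by linarith) hμ.le (by linarith) (rowSum_torus Nf hμ)
  have h := jointWalkExpansion_neumann_right (σ₁ := μ) (σ' := μ) (ρ := ρ) (ε := ε) (κ := κ) hK hS
    (fun i => LR.domBy_dist X i) (fun b => L₀.domBy_dist X b) hfib (rowSum_torus Nf hμ) (rowSum_torus Nf hμ) hμ.le hμ.le hc
    (by linarith) hε (by linarith) hρR hρ₀ (by linarith) (by linarith) (by positivity) (by positivity) hκ (by linarith)
    (by linarith) hq
  convert h using 2

/-- **Invertibility of `1 − R` under the margin smallness alone** (print p. 414: *"R satisfies the bound (3.85) with O(M⁻¹)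
instead of O(α₁). For M sufficiently large this implies G = G₀(I − R)⁻¹"*): on polydisc × ball,
`(1 − R(σ,u))·(1 − R(σ,u))⁻¹ = 1`. [cite: Balaban1985BackgroundPropagators, (3.106) p.414] -/
theorem one_sub_kernel_mul_inv (hR : IsDomainLocalD LR c locn locn X R lamR ρR rR mR nR) (hκ₁ : 0 ≤ c.κ₁)
    (hlamR : 0 ≤ lamR) (hfib : ∀ y : UT Nf, (Finset.univ.filter fun k => locn k = y).card ≤ m)
    {μ : ℝ} (hμ : 0 < μ) (hρR : 3 * μ ≤ ρR)
    (hq : (m * B6.c0 1 μ ^ ν) * ((lamR * Real.exp (c.κ₁ * mR)) * Real.exp (μ * rR) * (nR * B6.c0 1 μ ^ ν)) *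
      B6.c0 1 μ ^ ν < 1)
    {σ₀ : TPt d N' → ℂ} (hσ₀ : ∀ j, ‖σ₀ j‖ ≤ Real.exp c.κ₁) {u : E} (hu : u ∈ ball (0 : E) R) :
    (1 - LR.kernel σ₀ u) * (1 - LR.kernel σ₀ u)⁻¹ = 1 := by
  have hc : 0 ≤ B6.c0 1 μ ^ ν := pow_nonneg (B6RandomWalk.c0_nonneg 1 μ) ν
  have hK := jointWalkExpansion_domainLocalD hR hκ₁ hlamR (ε := μ) (κ := μ) (μ := μ)
    (by linarith) hμ.le hμ.le (by linarith) (rowSum_torus Nf hμ)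
  exact one_sub_mul_inv_of_jointWalkExpansion (σ₁ := μ) (σ' := μ) (ρ := ρR - μ) hK (fun i => LR.domBy_dist X i) hfib
    (rowSum_torus Nf hμ) (rowSum_torus Nf hμ) hμ.le hμ.le hc hμ.le (by linarith) (by linarith) le_rfl (by positivity) le_rfl
    hq hσ₀ hu

omit [Fintype n] [DecidableEq n] in
/-- **Domination for the walk distances of the parametrix × Neumann family** (so it can be multiplied ∕ sandwiched ∕
inverted again by the tree's algebra). [cite: Balaban1984PropagatorsII, (2.54) p.233; Balaban1985BackgroundPropagators, (3.93) p.410] -/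
theorem domBy_parametrixNeumann (X : Finset (UT Nf)) (p : List LR.B × L₀.B) :
    DomBy (toB6 (torusGeom Nf 0 0 0) 0 True) (fun a b => chainDist (g := toB6 (torusGeom Nf 0 0 0) 0 True)
      (fun i a b => LR.dist X i b a) (fun a b => L₀.dist X p.2 b a) p.1 b a) :=
  domBy_chain_right (DK := fun i => LR.dist X i) (DC := fun b => L₀.dist X b) (fun i => LR.domBy_dist X i)
    (fun b => L₀.domBy_dist X b) p

end Mechanism

/-! ## §2. The σ-free reading (no piece carries a decoupling parameter) -/

section SigmaFree

variable {p' : Type}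
variable {c : B13.Consts} {locp : p' → UT Nf} {locn : n → UT Nf} {X : Finset (UT Nf)} {R ε kap Kbar : ℝ}
variable {K : (TPt d N' → ℂ) → E → Matrix p' n ℂ}
variable {W : Type} {T T' : W → (TPt d N' → ℂ) → E → Matrix p' n ℂ} {SX : Set W} {A : W → ℝ}
variable {D : W → UT Nf → UT Nf → ℝ} {ρ : ℝ}

omit [Fintype n] [DecidableEq n] in
/-- **The terms enter the shape only pointwise**: transport along an equality of term families (used to read a family
whose pieces carry no `s`-parameter in the literal σ-free form). [cite: Balaban1985BackgroundPropagators, (3.107) p.416] -/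
theorem jointWalkExpansion_congr_terms (h : JointWalkExpansion c locp locn K X R ε kap Kbar T SX A D ρ)
    (hTT' : ∀ ω σ u, T ω σ u = T' ω σ u) : JointWalkExpansion c locp locn K X R ε kap Kbar T' SX A D ρ := by
  have e : T = T' := funext fun ω => funext fun σ => funext fun u => hTT' ω σ u
  subst e
  exact h

end SigmaFree

section SigmaFreeMechanism

variable {c : B13.Consts} {locn : n → UT Nf} {locq : q → UT Nf} {X : Finset (UT Nf)} {R : ℝ}
variable {L₀ : DomainTerms d N' ν Nf q n E} {LR : DomainTerms d N' ν Nf n n E}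
variable {lam₀ ρ₀ r₀ lamR ρR rR : ℝ} {n₀ nR m : ℕ}

omit [Fintype n] [DecidableEq n] in
/-- A piece with no decoupling parameter has the σ-free term `T_b(σ,u) = F_b(u)`. [cite: Balaban1988RG2Cluster, (1.11) p.5] -/
theorem term_eq_op_of_card_le_zero {p' : Type} (L : DomainTerms d N' ν Nf p' n E) (hJ : ∀ b, (L.J b).card ≤ 0) (b : L.B)
    (σ : TPt d N' → ℂ) (u : E) : L.term b σ u = L.op b u := by
  have h : L.J b = ∅ := Finset.card_eq_zero.1 (Nat.le_zero.1 (hJ b))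
  simp [DomainTerms.term, h]

omit [Fintype n] [DecidableEq n] in
/-- A family with no decoupling parameters has the σ-free kernel `K(σ,u) = Σ_b F_b(u)`. [cite: Balaban1985BackgroundPropagators, (3.107) p.416] -/
theorem kernel_eq_of_card_le_zero {p' : Type} (L : DomainTerms d N' ν Nf p' n E) (hJ : ∀ b, (L.J b).card ≤ 0)
    (σ : TPt d N' → ℂ) (u : E) : L.kernel σ u = ∑ b, L.op b u := by
  simp only [DomainTerms.kernel, term_eq_op_of_card_le_zero L hJ]

/-- **THE σ-FREE READING** — the input shape of the N10 junction (module 25's `structuredExpansion_sandwich_sDecorate_symm`,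
binder `h₀`): when no piece of `L₀`, `L_R` carries a decoupling parameter (`m₀ = m_R = 0`), the operator
`u ↦ (Σ_b F₀,b(u))·(1 − Σ_a F_R,a(u))⁻¹` has a joint walk expansion whose kernel and terms are LITERALLY σ-free and whose
σ-carrying sub-family is empty — same letters as §1. [cite: Balaban1985BackgroundPropagators, (3.106) p.414, Thm 3.10 (3.107)–(3.108) p.416; Balaban1988RG2Cluster, p.13, p.15] -/
theorem jointWalkExpansion_parametrixNeumann_sigmaFree
    (h₀ : IsDomainLocalD L₀ c locq locn X R lam₀ ρ₀ r₀ 0 n₀) (hR : IsDomainLocalD LR c locn locn X R lamR ρR rR 0 nR)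
    (hκ₁ : 0 ≤ c.κ₁) (hlam₀ : 0 ≤ lam₀) (hlamR : 0 ≤ lamR)
    (hfib : ∀ y : UT Nf, (Finset.univ.filter fun k => locn k = y).card ≤ m)
    {ρ ε κ μ : ℝ} (hμ : 0 < μ) (hε : 0 ≤ ε) (hκ : 0 ≤ κ) (hwin : κ + 2 * μ ≤ ρ - ε) (hρR : ρ + μ ≤ ρR) (hρ₀ : ρ ≤ ρ₀)
    (hq : (m * B6.c0 1 μ ^ ν) * (lamR * Real.exp (μ * rR) * (nR * B6.c0 1 μ ^ ν)) * B6.c0 1 μ ^ ν < 1) :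
    JointWalkExpansion c locq locn (fun (_ : TPt d N' → ℂ) u => (∑ b, L₀.op b u) * (1 - ∑ a, LR.op a u)⁻¹) X R ε κ
      ((lam₀ * Real.exp (μ * r₀) * (n₀ * B6.c0 1 μ ^ ν)) *
        (1 - (m * B6.c0 1 μ ^ ν) * (lamR * Real.exp (μ * rR) * (nR * B6.c0 1 μ ^ ν)) * B6.c0 1 μ ^ ν)⁻¹)
      (fun (p : List LR.B × L₀.B) (_ : TPt d N' → ℂ) u => p.1.foldr (fun i M => M * LR.op i u) (L₀.op p.2 u))
      (∅ : Set (List LR.B × L₀.B))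
      (fun p => chainConst (m : ℝ) (B6.c0 1 μ ^ ν) (fun _ : LR.B => lamR) lam₀ p.1)
      (fun p a b => chainDist (g := toB6 (torusGeom Nf 0 0 0) 0 True) (fun i a b => LR.dist X i b a)
        (fun a b => L₀.dist X p.2 b a) p.1 b a) ρ := by
  have h0J : ∀ b, (L₀.J b).card ≤ 0 := h₀.hJ
  have hRJ : ∀ a, (LR.J a).card ≤ 0 := hR.hJ
  have e₀ : lam₀ * Real.exp (c.κ₁ * (0 : ℕ)) = lam₀ := by simp
  have eR : lamR * Real.exp (c.κ₁ * (0 : ℕ)) = lamR := by simp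
  have hq' : (m * B6.c0 1 μ ^ ν) * ((lamR * Real.exp (c.κ₁ * (0 : ℕ))) * Real.exp (μ * rR) * (nR * B6.c0 1 μ ^ ν)) *
      B6.c0 1 μ ^ ν < 1 := by rwa [eR]
  have h := jointWalkExpansion_parametrixNeumann h₀ hR hκ₁ hlam₀ hlamR hfib hμ hε hκ hwin hρR hρ₀ hq'
  rw [e₀, eR] at h
  -- the σ-carrying sub-family is empty: no piece carries a parameter
  have hSX : {p : List LR.B × L₀.B | p.2 ∈ L₀.sigmaCarrying ∨ ∃ i ∈ p.1, i ∈ LR.sigmaCarrying} = ∅ := by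
    ext p
    simp only [Set.mem_setOf_eq, Set.mem_empty_iff_false, iff_false, not_or, not_exists, not_and]
    refine ⟨fun hb => ?_, fun i _ hi => ?_⟩
    · have h : L₀.J p.2 = ∅ := Finset.card_eq_zero.1 (Nat.le_zero.1 (h0J p.2))
      exact (Finset.not_nonempty_iff_eq_empty.2 h) hb
    · have h : LR.J i = ∅ := Finset.card_eq_zero.1 (Nat.le_zero.1 (hRJ i))
      exact (Finset.not_nonempty_iff_eq_empty.2 h) hi
  rw [hSX] at h
  -- kernel and terms read σ-free
  refine jointWalkExpansion_congr_terms (T := fun (p : List LR.B × L₀.B) σ u =>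
      p.1.foldr (fun i M => M * LR.term i σ u) (L₀.term p.2 σ u)) ?_ fun p σ u => ?_
  · refine
      { hasSum := fun σ hσ u hu i j => by
          have hs := h.hasSum σ hσ u hu i j
          rwa [kernel_eq_of_card_le_zero L₀ h0J, kernel_eq_of_card_le_zero LR hRJ] at hs
        termAnalytic := h.termAnalytic
        maj := h.maj
        majSum := h.majSum
        indep := h.indep
        through := h.through
        A_nonneg := h.A_nonneg
        D_nonneg := h.D_nonneg }
  · simp only [term_eq_op_of_card_le_zero L₀ h0J, term_eq_op_of_card_le_zero LR hRJ]

end SigmaFreeMechanism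

end Literature.MathematicalPhysics.QuantumFieldTheory.Balaban1983to89.B13ParametrixNeumannWalks

end
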